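import Literature.NumberTheory.Automorphic.UnitaryGroupRankOneAntidiagEntries   -- F2a (this seat): entries, Δ-identities, Borel∕scalar∕Weyl∕anti-diagonal members
import Mathlib.Topology.Algebra.Constructions
import Mathlib.Topology.Algebra.GroupWithZero
import Mathlib.Topology.Algebra.Monoid
import HarnessLib

/-!
# The class map `(tr, det)` of the quasi-split rank-one unitary group `U(J₂)(K)` is OPEN at every point («saturation», rank one)
(Langlands–Shelstad, *Descent for transfer factors* §2.2 p. 11 «because `G` is quasisplit»; Rogawski 1990 §3.1, §4.3)

Topic `NumberTheory/Automorphic`; namespace `Literature.NumberTheory.Automorphic.UnitaryGroup`.  THEOREMS ONLY (no definition, no instance, no notation,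
no named fact, no `sorry`).  Cell `pub/hodgecm-mathlib` (D-0151), crux H413 = stmt-HodgeConjecture-24833, F0∕P3a road «D-N6-ns», floor-2 line «N6nsGerm»,
stub `stub_N6nsGlue` SATURATION HALF (LEAD F0P3a-plan (g9) WORD T8-55 → B-p08 (g26); census `B-provers/B-p08/g26/sat/CENSUS-N6nsGlue-SATURATION.B-p08g26.md`
file F2 = (σ-OPEN) + (σ-DENSE) + realisation).  HONEST LABEL: HC_CM is proved only modulo the 2 remaining named inputs (hLiu418, h413) until rung 0 closes;
this file proves no letter.  FIELD-GENERIC: `K` a field with a ring involution `σ` (`σ ∘ σ = id`), `J₂ = antidiag(1, 1)`; the topological sections assume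
`K` a topological field with continuous inversion off `0` and `σ` continuous (the completed CM field `L_w` with its conjugation); the CM carrier
`(cmDatum L 2 Φ₂).Local v` is reached in the consumer through ★ `localNonsplitEquiv`.

THE MATHEMATICS.  Langlands–Shelstad's Lemma 2.2.A needs, at a point `ε` of `H(F)`, that every regular `γ` whose class is near that of `ε` be
stably conjugate INTO any neighbourhood of `ε` («because `G` is quasisplit», loc. cit. p. 11).  For `U(J₂)(K)`, `J₂` antidiagonal (the quasi-split
rank-one unitary group) we prove the underlying openness statement DIRECTLY, with no torus classification: write `g = (a b; c d)`, `Δ = det g`;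
unitarity `ᵗ(σg) J₂ g = J₂` is the four relations `σc·a + σa·c = 0`, `σc·b + σa·d = 1`, `σd·a + σb·c = 1`, `σd·b + σb·d = 0` (§1), whence
`σa·Δ = a`, `σb·Δ = −b`, `σc·Δ = −c`, `σd·Δ = d`, `σΔ·Δ = 1`, `σ(tr g)·Δ = tr g` (§1).  The BOREL elements `b(λ, ν) = (λ λν; 0 (σλ)⁻¹)` lie in `U(J₂)`
iff `σν = −ν` (§2).  **(σ-OPEN) at `A` with `A₁₀ = c ≠ 0`** (§3): for a target class `(t, Δe)` (`e σe = 1`, `σt·Δe = t` — automatic for the class of a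
unitary `g`) put `λ = (1+e)/2` (so `λ/σλ = e`) and `ν = (t − aλ − d(σλ)⁻¹)/(cλ)`; then `σν = −ν` BY the relations above, and `A·b(λ,ν) ∈ U(J₂)` has class
EXACTLY `(t, Δe)` and tends to `A` as `(e, t) → (1, tr A)` — so every neighbourhood `V ∋ A` in `U(J₂)(K)` captures an element of every unitary class near
that of `A` (continuity INTO the group is read through Mathlib's `Units.embedProduct` inducing with the explicit inverse `b(λ,ν)⁻¹ = (λ⁻¹ −νσλ; 0 σλ)`).
**(§4)** the property is invariant under conjugation by a fixed element of `U(J₂)(K)` and every NON-SCALAR `A` is conjugate (by `w = J₂` or a unipotent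
`u(ν₀)`) to one with `A₁₀ ≠ 0`.  **(σ-DENSE) (§5)**: a scalar `a·1` is the limit of the NON-SEMISIMPLE points `a·u(yσy·ν₀)` (`y → 0`) with the SAME
class `((a+a), a²)`; so at a scalar the openness statement holds with the SAME neighbourhood (apply §3–§4 at such a point inside `V`).  **(§6)** hence
`(tr, det) : U(J₂)(K) → K × K` is open onto its image at EVERY point, in neighbourhood form.  **(§0)** REALISATION: `g(t, r) = (0 (σr)⁻¹; r t) ∈ U(J₂)`
iff `σt·r + t·σr = 0`, `det = −r/σr`; with `r = 1 − Δ′` (or `r = ν₀(1 + Δ′)`) every admissible class `(t, Δ′)` is realised — the class image of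
`U(J₂)(K)` is the CLOSED set `{(t, Δ′) : Δ′σΔ′ = 1, σt·Δ′ = t}`.

## References
* [LanglandsShelstad1990Descent] R. P. Langlands, D. Shelstad, *Descent for transfer factors*, Progr. Math. 87 (1990), §2.2 Lemma 2.2.A pp. 10–11.
* [Rogawski1990] J. D. Rogawski, *Automorphic Representations of Unitary Groups in Three Variables*, Ann. of Math. Stud. 123 (1990): §3.1 p. 19 (stable
  conjugacy in `GL_n`), §4.3 p. 42, §1.9–1.10 pp. 8–9 (`Φ_N`, Borel subgroup).
* [Mok2014] C. P. Mok, *Endoscopic classification of representations of quasi-split unitary groups*, Mem. AMS 235 (2015), §1 Notation p. 5 (`U_{E/F}(N)`, `Φ_N`).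
-/

set_option autoImplicit false

noncomputable section

open Matrix Set Filter Topology
open scoped MatrixGroups

namespace Literature.NumberTheory.Automorphic.UnitaryGroup

open Literature.NumberTheory.Automorphic

/-! ## §3 (σ-OPEN) at a point with non-zero `(1,0)` entry: the explicit Borel section `A · b((1+e)/2, ν)` -/

section Helpers

variable {K : Type*} [TopologicalSpace K]

/-- Continuity at a point of a `2 × 2` matrix-valued map, from its entries. [cite: Rogawski1990, §1.10 p. 9] -/
theorem continuousAt_matrix_fin_two {X : Type*} [TopologicalSpace X] {f₀₀ f₀₁ f₁₀ f₁₁ : X → K} {x : X}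
    (h₀₀ : ContinuousAt f₀₀ x) (h₀₁ : ContinuousAt f₀₁ x) (h₁₀ : ContinuousAt f₁₀ x) (h₁₁ : ContinuousAt f₁₁ x) :
    ContinuousAt (fun p => !![f₀₀ p, f₀₁ p; f₁₀ p, f₁₁ p]) x := by
  refine continuousAt_pi.2 fun i => continuousAt_pi.2 fun j => ?_
  fin_cases i <;> fin_cases j <;> simpa

/-- Continuity of a `2 × 2` matrix-valued map, from its entries. [cite: Rogawski1990, §1.10 p. 9] -/
theorem continuous_matrix_fin_two {X : Type*} [TopologicalSpace X] {f₀₀ f₀₁ f₁₀ f₁₁ : X → K}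
    (h₀₀ : Continuous f₀₀) (h₀₁ : Continuous f₀₁) (h₁₀ : Continuous f₁₀) (h₁₁ : Continuous f₁₁) :
    Continuous (fun p => !![f₀₀ p, f₀₁ p; f₁₀ p, f₁₁ p]) := by
  refine continuous_pi fun i => continuous_pi fun j => ?_
  fin_cases i <;> fin_cases j <;> simpa

variable [Field K] {σ : K →+* K}

/-- The topology of `↥U(J)(K)` is induced by `u ↦ (u, (u⁻¹)ᵒᵖ)` into `M₂(K) × M₂(K)ᵐᵒᵖ` (subtype of `GL₂(K)`, itself embedded by `Units.embedProduct`).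
[cite: Mok2014, §1 Notation p. 5] -/
theorem isInducing_embedProduct_subtype (J : Matrix (Fin 2) (Fin 2) K) :
    IsInducing (fun u : ↥(unitaryGroupOfForm σ J) => Units.embedProduct (Matrix (Fin 2) (Fin 2) K) (u : GL (Fin 2) K)) :=
  Units.isInducing_embedProduct.comp Topology.IsInducing.subtypeVal

end Helpers

section Open

variable {K : Type*} [Field K] [TopologicalSpace K] [IsTopologicalRing K] [ContinuousInv₀ K] [T1Space K] {σ : K →+* K}

/-- **(σ-OPEN) AT A POINT `A ∈ U(J₂)(K)` WITH `A₁₀ ≠ 0`.**  For every neighbourhood `V` of `A` in `U(J₂)(K)` there is a neighbourhood `W` of the class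
`(tr A, det A)` in `K × K` such that every `g ∈ U(J₂)(K)` whose class `(tr g, det g)` lies in `W` has a class-mate `g′ ∈ V` (`tr g′ = tr g`,
`det g′ = det g`) — namely `g′ = A · b(λ, ν)` with `λ = (1 + det g ∕ det A)/2`, `ν = (tr g − A₀₀λ − A₁₁(σλ)⁻¹)/(A₁₀λ)` (§2; `σν = −ν` by §1's Δ-identities).
Hypotheses: `σ` a continuous involution, `2 ≠ 0` in `K`, inversion continuous off `0`, points closed.  This is «any regular `γ` close to `ε′` is stably
conjugate to a `γ″` close to `ε`, because `G` is quasisplit» at the points `A₁₀ ≠ 0` of the quasi-split rank-one unitary group.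
[cite: LanglandsShelstad1990Descent, §2.2 Lemma 2.2.A p. 11] [cite: Rogawski1990, §3.1 p. 19; §1.10 p. 9] -/
theorem exists_nhds_class_of_entry_ne_zero (hσ : ∀ x, σ (σ x) = x) (hσc : Continuous σ) (h2 : (2 : K) ≠ 0)
    (A : ↥(unitaryGroupOfForm σ !![(0 : K), 1; 1, 0])) (hc : (A : GL (Fin 2) K).val 1 0 ≠ 0)
    {V : Set ↥(unitaryGroupOfForm σ !![(0 : K), 1; 1, 0])} (hV : V ∈ 𝓝 A) :
    ∃ W ∈ 𝓝 (((A : GL (Fin 2) K).val.trace, (A : GL (Fin 2) K).val.det)),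
      ∀ g : ↥(unitaryGroupOfForm σ !![(0 : K), 1; 1, 0]), (((g : GL (Fin 2) K).val.trace, (g : GL (Fin 2) K).val.det)) ∈ W →
        ∃ g' ∈ V, (g' : GL (Fin 2) K).val.trace = (g : GL (Fin 2) K).val.trace ∧ (g' : GL (Fin 2) K).val.det = (g : GL (Fin 2) K).val.det := by
  obtain ⟨Au, hAu⟩ := A
  -- names for the entries of `A` and its determinant
  set a := Au.val 0 0 with ha_def
  set b := Au.val 0 1 with hb_def
  set c := Au.val 1 0 with hc_def
  set d := Au.val 1 1 with hd_def
  set Δ := Au.val.det with hΔ_def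
  have hΔ : Δ ≠ 0 := det_ne_zero_of_mem hAu
  have hAeta : Au.val = !![a, b; c, d] := Matrix.eta_fin_two _
  have htrA : Au.val.trace = a + d := Matrix.trace_fin_two _
  have h11 : ((1 : K) + 1) / 2 = 1 := by rw [show (1 : K) + 1 = 2 by norm_num, div_self h2]
  -- the pair family `Φ : p = (e, t) ↦ (A · b(λ, ν), (b(λ, ν)⁻¹ · A⁻¹)ᵒᵖ)`, `λ = (1+e)/2`, `ν = (t − aλ − d(σλ)⁻¹)/(cλ)` (an opaque local function)
  obtain ⟨Φ, hΦ⟩ : ∃ Φ : K × K → Matrix (Fin 2) (Fin 2) K × (Matrix (Fin 2) (Fin 2) K)ᵐᵒᵖ, ∀ p, Φ p =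
      (Au.val * !![(1 + p.1) / 2, (1 + p.1) / 2 * ((p.2 - a * ((1 + p.1) / 2) - d * (σ ((1 + p.1) / 2))⁻¹) / (c * ((1 + p.1) / 2))); 0, (σ ((1 + p.1) / 2))⁻¹],
        MulOpposite.op (!![((1 + p.1) / 2)⁻¹, -(((p.2 - a * ((1 + p.1) / 2) - d * (σ ((1 + p.1) / 2))⁻¹) / (c * ((1 + p.1) / 2))) * σ ((1 + p.1) / 2)); 0, σ ((1 + p.1) / 2)] * (Au⁻¹).val)) :=
    ⟨_, fun p => rfl⟩
  have hΦ_cont : ContinuousAt Φ (1, Au.val.trace) := by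
    have hlam_cont : Continuous fun p : K × K => (1 + p.1) / 2 := (continuous_const.add continuous_fst).div_const _
    have hlam_ne : (fun p : K × K => (1 + p.1) / 2) (1, Au.val.trace) ≠ 0 := by
      show ((1 : K) + 1) / 2 ≠ 0; rw [h11]; exact one_ne_zero
    have hσlam_cont : ContinuousAt (fun p : K × K => σ ((1 + p.1) / 2)) (1, Au.val.trace) := (hσc.comp hlam_cont).continuousAt
    have hσlam_ne : (fun p : K × K => σ ((1 + p.1) / 2)) (1, Au.val.trace) ≠ 0 := by
      show σ (((1 : K) + 1) / 2) ≠ 0; rw [h11, map_one]; exact one_ne_zero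
    have hσlaminv_cont : ContinuousAt (fun p : K × K => (σ ((1 + p.1) / 2))⁻¹) (1, Au.val.trace) := hσlam_cont.inv₀ hσlam_ne
    have hnu_cont : ContinuousAt (fun p : K × K => (p.2 - a * ((1 + p.1) / 2) - d * (σ ((1 + p.1) / 2))⁻¹) / (c * ((1 + p.1) / 2)))
        (1, Au.val.trace) := by
      refine ContinuousAt.div ?_ (continuousAt_const.mul hlam_cont.continuousAt) ?_
      · exact (continuous_snd.continuousAt.sub (continuousAt_const.mul hlam_cont.continuousAt)).sub (continuousAt_const.mul hσlaminv_cont)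
      · show c * (((1 : K) + 1) / 2) ≠ 0; rw [h11, mul_one]; exact hc
    rw [show Φ = fun p => (Au.val * !![(1 + p.1) / 2, (1 + p.1) / 2 * ((p.2 - a * ((1 + p.1) / 2) - d * (σ ((1 + p.1) / 2))⁻¹) / (c * ((1 + p.1) / 2))); 0, (σ ((1 + p.1) / 2))⁻¹],
        MulOpposite.op (!![((1 + p.1) / 2)⁻¹, -(((p.2 - a * ((1 + p.1) / 2) - d * (σ ((1 + p.1) / 2))⁻¹) / (c * ((1 + p.1) / 2))) * σ ((1 + p.1) / 2)); 0, σ ((1 + p.1) / 2)] * (Au⁻¹).val)) from funext hΦ]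
    refine (continuousAt_const.mul (continuousAt_matrix_fin_two hlam_cont.continuousAt (hlam_cont.continuousAt.mul hnu_cont)
      continuousAt_const hσlaminv_cont)).prodMk (MulOpposite.continuous_op.continuousAt.comp ?_)
    exact (continuousAt_matrix_fin_two (hlam_cont.continuousAt.inv₀ hlam_ne) (hnu_cont.mul hσlam_cont).neg continuousAt_const
      hσlam_cont).mul continuousAt_const
  -- its value at `(1, tr A)` is `(A, (A⁻¹)ᵒᵖ)`
  have hΦ₀ : Φ (1, Au.val.trace) = Units.embedProduct _ Au := by
    have hν0 : (Au.val.trace - a * 1 - d * 1) / (c * 1) = 0 := by rw [htrA, show a + d - a * 1 - d * 1 = 0 by ring, zero_div]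
    rw [hΦ]
    simp only [h11, map_one, inv_one, hν0, mul_zero, zero_mul, neg_zero, Units.embedProduct_apply]
    rw [← Matrix.one_fin_two, Matrix.mul_one, Matrix.one_mul]
  -- pull `V` back: `V ⊇ f⁻¹ O` for an `O ∈ 𝓝 (A, (A⁻¹)ᵒᵖ)`; `W := ` the preimage of `Φ⁻¹ O ∩ {λ ≠ 0}` under the class-to-parameter map `(t, δ) ↦ (δ/Δ, t)`
  have hind := isInducing_embedProduct_subtype (σ := σ) (!![(0 : K), 1; 1, 0])
  rw [hind.nhds_eq_comap, Filter.mem_comap] at hV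
  obtain ⟨O, hO, hOV⟩ := hV
  have hO' := hΦ_cont.preimage_mem_nhds (by rw [hΦ₀]; exact hO)
  have hL : {p : K × K | (1 + p.1) / 2 ≠ 0} ∈ 𝓝 ((1 : K), Au.val.trace) :=
    (isOpen_ne.preimage ((continuous_const.add continuous_fst).div_const _)).mem_nhds (by show ((1 : K) + 1) / 2 ≠ 0; rw [h11]; exact one_ne_zero)
  have hq : Continuous fun q : K × K => (q.2 / Δ, q.1) := (continuous_snd.div_const Δ).prodMk continuous_fst
  refine ⟨(fun q : K × K => (q.2 / Δ, q.1)) ⁻¹' (Φ ⁻¹' O ∩ {p : K × K | (1 + p.1) / 2 ≠ 0}), hq.continuousAt.preimage_mem_nhds ?_,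
    fun g hg => ?_⟩
  · show _ ∈ 𝓝 (Δ / Δ, Au.val.trace)
    rw [div_self hΔ]
    exact Filter.inter_mem hO' hL
  obtain ⟨gu, hgu⟩ := g
  simp only [Set.mem_preimage, Set.mem_inter_iff, Set.mem_setOf_eq] at hg
  obtain ⟨hgO, hglam⟩ := hg
  -- the parameters of `g`: `e = det g ∕ Δ`, `t = tr g`, `λ = (1 + e)/2`, `μ = (σλ)⁻¹`, `ν`
  set e : K := gu.val.det / Δ with he_def
  set t : K := gu.val.trace with ht_def
  set lam : K := (1 + e) / 2 with hlam_def
  have hlam : lam ≠ 0 := hglam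
  have hσlam : σ lam ≠ 0 := fun h => hlam (by rw [← hσ lam, h, map_zero])
  set nu : K := (t - a * lam - d * (σ lam)⁻¹) / (c * lam) with hnu_def
  have he0 : e ≠ 0 := div_ne_zero (det_ne_zero_of_mem hgu) hΔ
  have hσΔ : σ Δ ≠ 0 := fun h => by
    have h2 := sigma_det_mul_det_of_mem hAu
    rw [← hΔ_def, h, zero_mul] at h2
    exact zero_ne_one h2
  -- (a) `e · σe = 1`
  have heσ : e * σ e = 1 := by
    have hg1 := sigma_det_mul_det_of_mem hgu
    have hA1 := sigma_det_mul_det_of_mem hAu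
    rw [← hΔ_def] at hA1
    simp only [he_def, map_div₀]
    field_simp
    linear_combination hg1 - hA1
  -- (b) `Δ · e = det g` and `σ t · (Δ e) = t`
  have hΔe : Δ * e = gu.val.det := by simp only [he_def]; field_simp
  have hσt : σ t * (Δ * e) = t := by rw [hΔe]; exact sigma_trace_mul_det_of_mem hgu
  -- (c) `λ = e · σλ`
  have hσlam_eq : σ lam = (1 + σ e) / 2 := by
    simp only [hlam_def, map_div₀, map_add, map_one, map_ofNat]
  have hlam_eq : lam = e * σ lam := by
    rw [hσlam_eq, hlam_def]
    field_simp
    linear_combination -heσ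
  -- (d) the Δ-identities of `A` as quotients
  obtain ⟨hσa, -, hσc', hσd⟩ := sigma_entries_mul_det_of_mem hAu
  rw [← ha_def, ← hΔ_def] at hσa
  rw [← hc_def, ← hΔ_def] at hσc'
  rw [← hd_def, ← hΔ_def] at hσd
  have hσa' : σ a = a / Δ := by field_simp; exact hσa
  have hσc'' : σ c = -c / Δ := by field_simp; linear_combination hσc'
  have hσd' : σ d = d / Δ := by field_simp; exact hσd
  have hσt' : σ t = t / (Δ * e) := by field_simp; linear_combination hσt
  -- (e) THE KEY IDENTITY `σN·D + N·σD = 0` for `N = t − aλ − d(σλ)⁻¹`, `D = cλ`; hence `σν = −ν`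
  have hKEY : (σ t - σ a * σ lam - σ d * lam⁻¹) * (c * lam) + (t - a * lam - d * (σ lam)⁻¹) * (σ c * σ lam) = 0 := by
    rw [hσa', hσc'', hσd', hσt']
    set S := σ lam with hS
    rw [hlam_eq]
    field_simp
    ring
  have hσnu : σ nu = -nu := by
    have hD : c * lam ≠ 0 := mul_ne_zero hc hlam
    have hσD : σ c * σ lam ≠ 0 := mul_ne_zero (fun h => hc (by rw [← hσ c, h, map_zero])) hσlam
    simp only [hnu_def, map_div₀, map_sub, map_mul, map_inv₀, hσ]
    rw [eq_neg_iff_add_eq_zero, div_add_div _ _ hσD hD, div_eq_zero_iff]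
    exact Or.inl (by linear_combination hKEY)
  -- (f) the unit `b(λ, ν)` (made opaque) and the element `g′ = A · b(λ, ν)`
  obtain ⟨hb1, hb2⟩ := borel_mul_borelInv_eq_one hσ nu hlam
  obtain ⟨bU, hbUval, hbUinv, hbUmem⟩ : ∃ bU : GL (Fin 2) K, bU.val = !![lam, lam * nu; 0, (σ lam)⁻¹] ∧
      (bU⁻¹).val = !![lam⁻¹, -(nu * σ lam); 0, σ lam] ∧ bU ∈ unitaryGroupOfForm σ !![(0 : K), 1; 1, 0] :=
    ⟨⟨_, _, hb1, hb2⟩, rfl, rfl, borel_mem_unitaryGroupOfForm_antidiag hσ hlam hσnu hb1 hb2⟩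
  have hval : Φ (e, t) = Units.embedProduct _ (Au * bU) := by
    rw [hΦ, Units.embedProduct_apply, Units.val_mul, hbUval, _root_.mul_inv_rev, Units.val_mul, hbUinv]
  have hmemO : Units.embedProduct _ (Au * bU) ∈ O := by rw [← hval]; exact hgO
  have hinV : (⟨Au * bU, mul_mem hAu hbUmem⟩ : ↥(unitaryGroupOfForm σ !![(0 : K), 1; 1, 0])) ∈ V := by
    apply hOV
    show Units.embedProduct _ (Au * bU) ∈ O
    exact hmemO
  refine ⟨_, hinV, ?_, ?_⟩
  · -- trace
    show (Au * bU).val.trace = t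
    rw [Units.val_mul, hbUval, hAeta, Matrix.mul_fin_two, Matrix.trace_fin_two]
    simp only [Matrix.of_apply, Matrix.cons_val', Matrix.cons_val_zero, Matrix.cons_val_one, Matrix.empty_val', Matrix.cons_val_fin_one]
    rw [hnu_def]
    field_simp
    ring
  · -- determinant
    show (Au * bU).val.det = gu.val.det
    rw [Units.val_mul, hbUval, Matrix.det_mul, ← hΔ_def, Matrix.det_fin_two_of, ← hΔe, mul_zero, sub_zero]
    congr 1
    rw [mul_inv_eq_iff_eq_mul₀ hσlam]
    exact hlam_eq

/-! ## §4 Transport under conjugation by a fixed element; every non-scalar point is conjugate to one with `A₁₀ ≠ 0` -/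

omit [ContinuousInv₀ K] [T1Space K] in
/-- **Conjugation invariance of the openness property.**  If the class map is open (in neighbourhood form) at `x A x⁻¹` for some `x ∈ U(J₂)(K)`, it is open
at `A`: conjugation by `x` is a homeomorphism of `U(J₂)(K)` preserving `(tr, det)`. [cite: Rogawski1990, §3.1 p. 19] -/
theorem exists_nhds_class_of_conj (x A : ↥(unitaryGroupOfForm σ !![(0 : K), 1; 1, 0]))
    (h : ∀ V' ∈ 𝓝 (x * A * x⁻¹), ∃ W ∈ 𝓝 ((↑(x * A * x⁻¹) : GL (Fin 2) K).val.trace, (↑(x * A * x⁻¹) : GL (Fin 2) K).val.det),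
      ∀ g : ↥(unitaryGroupOfForm σ !![(0 : K), 1; 1, 0]), (((g : GL (Fin 2) K).val.trace, (g : GL (Fin 2) K).val.det)) ∈ W →
        ∃ g' ∈ V', (g' : GL (Fin 2) K).val.trace = (g : GL (Fin 2) K).val.trace ∧ (g' : GL (Fin 2) K).val.det = (g : GL (Fin 2) K).val.det)
    {V : Set ↥(unitaryGroupOfForm σ !![(0 : K), 1; 1, 0])} (hV : V ∈ 𝓝 A) :
    ∃ W ∈ 𝓝 (((A : GL (Fin 2) K).val.trace, (A : GL (Fin 2) K).val.det)),
      ∀ g : ↥(unitaryGroupOfForm σ !![(0 : K), 1; 1, 0]), (((g : GL (Fin 2) K).val.trace, (g : GL (Fin 2) K).val.det)) ∈ W →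
        ∃ g' ∈ V, (g' : GL (Fin 2) K).val.trace = (g : GL (Fin 2) K).val.trace ∧ (g' : GL (Fin 2) K).val.det = (g : GL (Fin 2) K).val.det := by
  -- pull `V` back along `u ↦ x⁻¹ u x`
  have hφ : Continuous fun u : ↥(unitaryGroupOfForm σ !![(0 : K), 1; 1, 0]) => x⁻¹ * u * x := (continuous_const.mul continuous_id).mul continuous_const
  have hφA : x⁻¹ * (x * A * x⁻¹) * x = A := by group
  obtain ⟨W, hW, hWp⟩ := h _ (hφ.continuousAt.preimage_mem_nhds (by rw [hφA]; exact hV))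
  rw [(trace_det_conj_eq A x).1, (trace_det_conj_eq A x).2] at hW
  refine ⟨W, hW, fun g hg => ?_⟩
  obtain ⟨g'', hg''V, htr, hdet⟩ := hWp g hg
  refine ⟨x⁻¹ * g'' * x, hg''V, ?_, ?_⟩
  · rw [← htr, ← (trace_det_conj_eq g'' x⁻¹).1, inv_inv]
  · rw [← hdet, ← (trace_det_conj_eq g'' x⁻¹).2, inv_inv]

/-! ## §5 (σ-DENSE): a scalar point is a limit of non-scalar points with the same class -/

omit [ContinuousInv₀ K] [T1Space K] in
/-- **(σ-DENSE).**  Let `A = a·1 ∈ U(J₂)(K)` be SCALAR (`A₀₁ = A₁₀ = 0`, `A₀₀ = A₁₁`).  Every neighbourhood `V` of `A` contains a NON-SCALAR element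
`n` (indeed `n₀₁ ≠ 0`) with the SAME class: `n = (a aν; 0 a)` with `ν = yσ(y)ν₀`, `y ≠ 0` small (`σν₀ = −ν₀`, `ν₀ ≠ 0`; `K` non-discrete at `0`).
Then `tr n = tr A`, `det n = det A` (and `n` is not semisimple). [cite: LanglandsShelstad1990Descent, §2.2 p. 11] [cite: Rogawski1990, §1.10 p. 9] -/
theorem exists_nonscalar_mem_nhds_of_scalar (hσ : ∀ x, σ (σ x) = x) (hσc : Continuous σ) {ν₀ : K} (hν₀ : σ ν₀ = -ν₀) (hν₀0 : ν₀ ≠ 0)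
    [(𝓝[≠] (0 : K)).NeBot] (A : ↥(unitaryGroupOfForm σ !![(0 : K), 1; 1, 0]))
    (hb : (A : GL (Fin 2) K).val 0 1 = 0) (hc : (A : GL (Fin 2) K).val 1 0 = 0) (had : (A : GL (Fin 2) K).val 0 0 = (A : GL (Fin 2) K).val 1 1)
    {V : Set ↥(unitaryGroupOfForm σ !![(0 : K), 1; 1, 0])} (hV : V ∈ 𝓝 A) :
    ∃ n ∈ V, (n : GL (Fin 2) K).val 0 1 ≠ 0 ∧
      (n : GL (Fin 2) K).val.trace = (A : GL (Fin 2) K).val.trace ∧ (n : GL (Fin 2) K).val.det = (A : GL (Fin 2) K).val.det := by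
  obtain ⟨Au, hAu⟩ := A
  change Au.val 0 1 = 0 at hb
  change Au.val 1 0 = 0 at hc
  change Au.val 0 0 = Au.val 1 1 at had
  obtain ⟨a, ha⟩ : ∃ a : K, Au.val 0 0 = a := ⟨_, rfl⟩
  have hAeta : Au.val = !![a, 0; 0, a] := by
    rw [Matrix.eta_fin_two Au.val, hb, hc, ← had, ha]
  -- `σa · a = 1` and `a ≠ 0`
  have hσa : σ a * a = 1 := by
    obtain ⟨-, h2, -, -⟩ := (mem_unitaryGroupOfForm_antidiag_iff σ Au).1 hAu
    rw [hc, map_zero, zero_mul, zero_add, ← had, ha] at h2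
    exact h2
  have ha0 : a ≠ 0 := fun h => by rw [h, mul_zero] at hσa; exact zero_ne_one hσa
  have hAinv : (Au⁻¹).val = !![a⁻¹, 0; 0, a⁻¹] := by
    rw [Matrix.coe_units_inv, hAeta]
    exact Matrix.inv_eq_left_inv (scalar_mul_scalarInv_eq_one ha0).2
  -- the family `y ↦ (n(y), (n(y)⁻¹)ᵒᵖ)`, `n(y) = (a aν; 0 a)`, `ν = y σy ν₀`
  obtain ⟨Φ, hΦ⟩ : ∃ Φ : K → Matrix (Fin 2) (Fin 2) K × (Matrix (Fin 2) (Fin 2) K)ᵐᵒᵖ, ∀ y, Φ y =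
      (!![a, a * (y * σ y * ν₀); 0, a], MulOpposite.op !![a⁻¹, -(y * σ y * ν₀ * a⁻¹); 0, a⁻¹]) := ⟨_, fun y => rfl⟩
  have hΦ_cont : Continuous Φ := by
    rw [show Φ = fun y => (!![a, a * (y * σ y * ν₀); 0, a], MulOpposite.op !![a⁻¹, -(y * σ y * ν₀ * a⁻¹); 0, a⁻¹]) from funext hΦ]
    have hν : Continuous fun y : K => y * σ y * ν₀ := (continuous_id.mul hσc).mul continuous_const
    exact (continuous_matrix_fin_two continuous_const (continuous_const.mul hν) continuous_const continuous_const).prodMk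
      (MulOpposite.continuous_op.comp
        (continuous_matrix_fin_two continuous_const (hν.mul continuous_const).neg continuous_const continuous_const))
  have hΦ₀ : Φ 0 = Units.embedProduct _ Au := by
    rw [hΦ, Units.embedProduct_apply, hAeta, hAinv]
    simp only [zero_mul, mul_zero, neg_zero]
  -- pull `V` back and pick `y ≠ 0` small
  have hind := isInducing_embedProduct_subtype (σ := σ) (!![(0 : K), 1; 1, 0])
  rw [hind.nhds_eq_comap, Filter.mem_comap] at hV
  obtain ⟨O, hO, hOV⟩ := hV
  have hO' : Φ ⁻¹' O ∈ 𝓝 (0 : K) := hΦ_cont.continuousAt.preimage_mem_nhds (by rw [hΦ₀]; exact hO)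
  have hmem : Φ ⁻¹' O ∩ {0}ᶜ ∈ 𝓝[≠] (0 : K) := Filter.inter_mem (mem_nhdsWithin_of_mem_nhds hO') self_mem_nhdsWithin
  obtain ⟨y, hyO, hy0⟩ := Filter.nonempty_of_mem hmem
  rw [Set.mem_compl_iff, Set.mem_singleton_iff] at hy0
  -- the element `n(y)`
  obtain ⟨ν, hν_def⟩ : ∃ ν : K, ν = y * σ y * ν₀ := ⟨_, rfl⟩
  have hσν : σ ν = -ν := by rw [hν_def, map_mul, map_mul, hσ, hν₀]; ring
  have hn1 : !![a, a * ν; 0, a] * !![a⁻¹, -(ν * a⁻¹); 0, a⁻¹] = 1 := by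
    ext i j; fin_cases i <;> fin_cases j <;> simp [Matrix.mul_apply, Fin.sum_univ_two, ha0]
    all_goals ring
  have hn2 : !![a⁻¹, -(ν * a⁻¹); 0, a⁻¹] * !![a, a * ν; 0, a] = 1 := by
    ext i j; fin_cases i <;> fin_cases j <;> simp [Matrix.mul_apply, Fin.sum_univ_two, ha0]
  have hnmem : (⟨!![a, a * ν; 0, a], !![a⁻¹, -(ν * a⁻¹); 0, a⁻¹], hn1, hn2⟩ : GL (Fin 2) K) ∈ unitaryGroupOfForm σ !![(0 : K), 1; 1, 0] := by
    rw [mem_unitaryGroupOfForm_iff]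
    ext i j
    rw [transpose_map_mul_antidiag_mul_apply]
    fin_cases i <;> fin_cases j <;> simp [hσν, hσa]
    -- the `(1,1)` relation `σa·aν + σ(aν)·a = 0`
    all_goals ring
  obtain ⟨nU, hnUval, hnUinv, hnUmem⟩ : ∃ nU : GL (Fin 2) K, nU.val = !![a, a * ν; 0, a] ∧ (nU⁻¹).val = !![a⁻¹, -(ν * a⁻¹); 0, a⁻¹] ∧
      nU ∈ unitaryGroupOfForm σ !![(0 : K), 1; 1, 0] := ⟨_, rfl, rfl, hnmem⟩
  have hval : Φ y = Units.embedProduct _ nU := by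
    rw [hΦ, Units.embedProduct_apply, hnUval, hnUinv, hν_def]
  have hinV : (⟨nU, hnUmem⟩ : ↥(unitaryGroupOfForm σ !![(0 : K), 1; 1, 0])) ∈ V := by
    apply hOV
    show Units.embedProduct _ nU ∈ O
    rw [← hval]; exact hyO
  refine ⟨_, hinV, ?_, ?_, ?_⟩
  · show nU.val 0 1 ≠ 0
    rw [hnUval]
    have hσy : σ y ≠ 0 := fun h => hy0 (by rw [← hσ y, h, map_zero])
    simp only [Matrix.of_apply, Matrix.cons_val', Matrix.cons_val_zero, Matrix.cons_val_one, Matrix.empty_val', Matrix.cons_val_fin_one]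
    rw [hν_def]
    exact mul_ne_zero ha0 (mul_ne_zero (mul_ne_zero hy0 hσy) hν₀0)
  · show nU.val.trace = Au.val.trace
    rw [hnUval, hAeta, Matrix.trace_fin_two_of, Matrix.trace_fin_two_of]
  · show nU.val.det = Au.val.det
    rw [hnUval, hAeta, Matrix.det_fin_two_of, Matrix.det_fin_two_of]
    ring

/-! ## §6 The class map is open (onto its image) at EVERY point of `U(J₂)(K)` -/

/-- **OPENNESS OF THE CLASS MAP `(tr, det)` AT EVERY POINT OF THE QUASI-SPLIT RANK-ONE UNITARY GROUP** (saturation, rank one).  `K` a topological field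
with continuous inversion off `0`, non-discrete at `0`, points closed; `σ` a continuous involution with a non-zero anti-invariant `ν₀` (`σν₀ = −ν₀`,
i.e. `σ ≠ id`); `2 ≠ 0`.  For every `A ∈ U(J₂)(K)` and every OPEN `V ∋ A` there is a neighbourhood `W` of the class `(tr A, det A)` such that every
`g ∈ U(J₂)(K)` with class in `W` has a class-mate `g′ ∈ V`.  Proof: non-scalar `A` — conjugate to `A₁₀ ≠ 0` (§4) and use §3; scalar `A` — §5 gives a
non-scalar `n ∈ V` with the same class, and the non-scalar case at `n` serves `A` with the same `V`.  (Consumer: with `g` `G`-regular the class-mate is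
STABLY CONJUGATE to `g` — same separable characteristic polynomial `X² − tr·X + det`, ★ `isConj_of_charpoly_eq_of_separable`.)
[cite: LanglandsShelstad1990Descent, §2.2 Lemma 2.2.A p. 11] [cite: Rogawski1990, §3.1 p. 19] -/
theorem exists_nhds_class (hσ : ∀ x, σ (σ x) = x) (hσc : Continuous σ) (h2 : (2 : K) ≠ 0) {ν₀ : K} (hν₀ : σ ν₀ = -ν₀) (hν₀0 : ν₀ ≠ 0)
    [(𝓝[≠] (0 : K)).NeBot] (A : ↥(unitaryGroupOfForm σ !![(0 : K), 1; 1, 0])) {V : Set ↥(unitaryGroupOfForm σ !![(0 : K), 1; 1, 0])} (hVo : IsOpen V) (hAV : A ∈ V) :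
    ∃ W ∈ 𝓝 (((A : GL (Fin 2) K).val.trace, (A : GL (Fin 2) K).val.det)),
      ∀ g : ↥(unitaryGroupOfForm σ !![(0 : K), 1; 1, 0]), (((g : GL (Fin 2) K).val.trace, (g : GL (Fin 2) K).val.det)) ∈ W →
        ∃ g' ∈ V, (g' : GL (Fin 2) K).val.trace = (g : GL (Fin 2) K).val.trace ∧ (g' : GL (Fin 2) K).val.det = (g : GL (Fin 2) K).val.det := by
  obtain ⟨w, hw, hw'⟩ := exists_weyl_elt (σ := σ) (K := K)
  obtain ⟨u, hu, hu'⟩ := exists_unipotent_elt hσ hν₀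
  -- the non-scalar case, for any point `B ∈ V`
  have key : ∀ B : ↥(unitaryGroupOfForm σ !![(0 : K), 1; 1, 0]), B ∈ V →
      ((B : GL (Fin 2) K).val 1 0 ≠ 0 ∨ (B : GL (Fin 2) K).val 0 1 ≠ 0 ∨ (B : GL (Fin 2) K).val 0 0 ≠ (B : GL (Fin 2) K).val 1 1) →
      ∃ W ∈ 𝓝 (((B : GL (Fin 2) K).val.trace, (B : GL (Fin 2) K).val.det)),
        ∀ g : ↥(unitaryGroupOfForm σ !![(0 : K), 1; 1, 0]), (((g : GL (Fin 2) K).val.trace, (g : GL (Fin 2) K).val.det)) ∈ W →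
          ∃ g' ∈ V, (g' : GL (Fin 2) K).val.trace = (g : GL (Fin 2) K).val.trace ∧ (g' : GL (Fin 2) K).val.det = (g : GL (Fin 2) K).val.det := by
    intro B hBV hB
    have hVB : V ∈ 𝓝 B := hVo.mem_nhds hBV
    by_cases hc : (B : GL (Fin 2) K).val 1 0 ≠ 0
    · exact exists_nhds_class_of_entry_ne_zero hσ hσc h2 B hc hVB
    rw [not_ne_iff] at hc
    by_cases hb : (B : GL (Fin 2) K).val 0 1 ≠ 0
    · -- conjugate by `w`
      refine exists_nhds_class_of_conj w B (fun V' hV' => exists_nhds_class_of_entry_ne_zero hσ hσc h2 _ ?_ hV') hVB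
      rw [conj_entry_one_zero_of_val_eq_weyl w B hw hw']
      exact hb
    rw [not_ne_iff] at hb
    have had : (B : GL (Fin 2) K).val 0 0 ≠ (B : GL (Fin 2) K).val 1 1 := by
      rcases hB with h | h | h
      · exact absurd hc h
      · exact absurd hb h
      · exact h
    -- diagonal non-scalar: conjugate by `u(ν₀)`, then by `w`
    refine exists_nhds_class_of_conj u B (fun V' hV' => ?_) hVB
    refine exists_nhds_class_of_conj w _ (fun V'' hV'' => exists_nhds_class_of_entry_ne_zero hσ hσc h2 _ ?_ hV'') hV'
    rw [conj_entry_one_zero_of_val_eq_weyl w _ hw hw', conj_entry_zero_one_of_val_eq_unipotent u B hu hu' hb hc]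
    exact mul_ne_zero hν₀0 (sub_ne_zero.2 had.symm)
  by_cases hA : (A : GL (Fin 2) K).val 1 0 ≠ 0 ∨ (A : GL (Fin 2) K).val 0 1 ≠ 0 ∨ (A : GL (Fin 2) K).val 0 0 ≠ (A : GL (Fin 2) K).val 1 1
  · exact key A hAV hA
  · -- scalar point: move to a non-scalar `n ∈ V` with the same class
    simp only [not_or, ne_eq, not_not] at hA
    obtain ⟨hc, hb, had⟩ := hA
    obtain ⟨n, hnV, hn01, htr, hdet⟩ := exists_nonscalar_mem_nhds_of_scalar hσ hσc hν₀ hν₀0 A hb hc had (hVo.mem_nhds hAV)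
    rw [← htr, ← hdet]
    exact key n hnV (Or.inr (Or.inl hn01))

end Open

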